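import Summits.Ventures.AbcSig.Rows.XTemplateC2a
import Summits.Ventures.AbcSig.Levels.N11168
import Summits.Ventures.AbcSig.Levels.N698

/-!
# Venture AbcSig — ROW `C2aL349A3`: `xⁿ + 2^3·349^m·yⁿ = z²`, class `a = 3`, over the level files 11168 (norm-form certificates) and 698 (ordinary tree certificates) (GENERATED by p-lean g4 `gen4/c2arow2.py`)

HONEST FRAMING. A row of a COMPUTATION cell (`pub-abcsig`); a CONDITIONAL theorem, no claim on ABC or any summit.
Hypotheses: `BS04Package` (CITED: [BS04] Lemma 3.3 + (3.1) + Lemma 4.2); `DataComplete` at both levels and `RefinesCPSymAll` at the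
norm-form level(s) (COMPUTED: certified engine-1 level files; `Sieve/CharpolyCert.lean` / `Sieve/CharpolyTwist.lean`);
and the listed per-orbit exclusions `hX_…` (CITED: the row of record's module closures — M4 Kraus / M6 / M8 / [BS04, Prop 4.4/4.6] as its R3
names them; nothing of those is checked here). Exponent range: prime `n ≥ 11`, `n ≠ 349`, n ∉ [11]; `B = 2^3·349^m`, `1 ≤ m < n`
(RULING H1 reduced exponents).
Residual of record R = {11} EXCLUDED in the statement (hres). CITED per the row of record's R3 at 11168: 11168.8 @ 17: M4/M6c-old. Level 698 (tree): no residue ≥ 11.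
Row of record: `census/rows/C2a/C2a-l349-a3.md` (sha16 `6a4dc4447c1ca30e`; SIGNED 2026-08-22T17:51:55Z by referee (ref-g14)).
-/

namespace Summit.Ventures.AbcSig

/-- Row `C2aL349A3`: class `a = 3`, first distribution, prime `n ≥ 11`, `n ≠ 349`, `n ∉ [11]`; conditional on the named hypotheses. -/
theorem xrow_C2aL349A3 (M : NewformModel) (hP : M.BS04Package)
    (hD11168 : M.DataComplete 11168 level11168Orbits) (hCP11168 : M.RefinesCPSymAll 11168 level11168CP)
    (hD698 : M.DataComplete 698 level698Orbits)
    (n : ℕ) (hn : n.Prime) (hmin : 11 ≤ n) (hnℓ : n ≠ 349) (hres : n ∉ ([11] : List ℕ)) (m : ℕ) (hm : 1 ≤ m) (hmn : m < n)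
    (hX_orbit_11168_8 : n ∈ ([17] : List ℕ) → M.Excludes 11168 orbit_11168_8
      (famB (2 ^ 3 * 349 ^ m) n (fun _ _ => True)))
    (x y z : ℤ) (hxy1 : x * y ≠ 1) (hxy2 : x * y ≠ -1) : ¬ IsPrimitiveSolution 1 (2 ^ 3 * 349 ^ m) 1 n x y z := by
  have hℓ : Nat.Prime 349 := by norm_num
  have h7 : 7 ≤ n := by omega
  exact xrowC2a_a3 349 hℓ (by norm_num) M hP n hn h7 hnℓ hD11168 hD698 m hm hmn
    (level11168_sieve M hP hCP11168 n hn h7 (fun o => M.Excludes 11168 o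
      (famB (2 ^ 3 * 349 ^ m) n (fun _ _ => True)) ∨ M.ExcludesStd 11168 o n) (fun _ h => Or.inr h) (fun hmem => by
      obtain rfl : n = 17 := by simpa using hmem
      exact Or.inl (hX_orbit_11168_8 (by simp))))
    (level698_sieve n hn h7 (fun o => M.Excludes 698 o
      (famB (2 ^ 3 * 349 ^ m) n (fun _ _ => True)) ∨ M.ExcludesStd 698 o n) (fun hmem => by
      obtain rfl : n = 7 := by simpa using hmem
      omega) (fun hmem => by
      obtain rfl : n = 7 := by simpa using hmem
      omega) (fun hmem => by
      rcases (by simpa using hmem : n = 7 ∨ n = 11) with rfl | rfl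
      · omega
      · exact absurd (by simp) hres))
    x y z hxy1 hxy2

end Summit.Ventures.AbcSig
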